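import Summits.BirchSwinnertonDyer.Rank1Residual.X1.RelaxedKummerCountPow
import Summits.BirchSwinnertonDyer.Rank1Residual.X1.GeneratorCountLayerLocal
import HarnessLib

/-!
# Route M's generator COUNT at LAYER `n`, IX: the loss factor `#E_{K_n}[p^∞]^{Γ_{K_n}}` in `K`-level
# terms, and the layer-`n` count at `v₀` with the finiteness of `E(K_∞)[p^∞]` as a `K`-level
# hypothesis (cell `b2b-bsdres`, unit `b2b-bsdres-eisenstein-p1`, gen 19; X1R0-GAPMAP §28)

HONEST FRAMING (run/shared/lean/b2b/bsd-rank1-residual/, verbatim in every file): the goal of the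
cell is to DELETE the COMBINATION-SHAPED residual classes of the Birch–Swinnerton-Dyer formula for
ALL analytic-rank `≤ 1` elliptic curves over `ℚ` — "full BSD formula for every rank `≤ 1` curve in
class `C`" assembled STRICTLY from published theorems — so that the rank-`≤ 1` remainder becomes
exactly the CONSTRUCTION-SHAPED classes, which are TYPED (missing-input `Prop`s), NOT attempted.
This is not "finishing BSD". Sub-cell `b2b-bsdres-eisenstein-p1` (CLASS-OWNERS row "X1 (r = 0)"):
research route; NO CLAIM BEYOND STATED CLASSES; nothing here changes a label; nothing is booked.
THEOREMS ONLY — no definition, no named fact, no typed input introduced; nothing about any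
particular curve asserted.

## What and why

The lossy layer-`n` counts (FILE 8, FILE 23b `GeneratorCountLayerLocal`) carry the finiteness of
`E_{K_n}[p^∞]^{ker κ_n}` as an INSTANCE hypothesis and the loss factor `#E_{K_n}[p^∞]^{Γ_{K_n}}` in
`K_n`-level terms. Consumers over `ℚ` live in a different import context (X2's reduction datum,
`X1/StrictAtPOfInertia*`), where these `K_n`-level types elaborate along other instance paths
(X1R0-GAPMAP §27.3). This file restates both in `K`-LEVEL terms, transported along n1011's
`primaryBaseChangeEquiv` / `kerOfKer` / `resGal`:

* `finite_fixedPoints_kerSubgroup_restrictTower`: `{b ∈ E[p^∞] | ker κ · b = b}` finite ⇒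
  `E_{K_n}[p^∞]^{ker κ_n}` finite (`β⁻¹(kerOfKer τ • a) = τ • β⁻¹ a`);
* `natCard_fixedPoints_layer_eq`: `#E_{K_n}[p^∞]^{Γ_{K_n}} = #{b ∈ E[p^∞] | κ⁻¹(pⁿℤ_p) · b = b}`
  (`β⁻¹(σ' • a) = resGal σ' • β⁻¹ a`, `resGal(Γ_{K_n}) = κ⁻¹(pⁿℤ_p)`);
* `pow_card_add_le_natCard_quotient_layerIdeal_mul_sq'`, `pow_card_add_le_pow_mul_sq'`: the
  layer-`n` count at `v₀` of route R1′ (FILE 24a's relaxed subgroup of index `p^e` at `wp ∣ v₀`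
  counted by FILE 23b, the `K_∞`-condition at `v₀` as the hypothesis `hv₀`) with the finiteness as the
  `K`-level hypothesis `hfix` and the loss factor in `K`-level form:
  **`p^{#T₀ + e} ≤ p^{λ + pⁿμ} · #{b ∈ E[p^∞] | Gal(K̄/K_n) · b = b}²`**.

References: [GreenbergLNM1716] §3 Lemma 3.1, Lemma 3.4, §5 pp. 114–118, p. 137;
[SerreGaloisCohomology1997] I.§2.4; X1R0-GAPMAP §14.1, §26–§28.
-/

noncomputable section

open scoped Classical

open Function Field NumberField IsDedekindDomain WeierstrassCurve PowerSeries
  Literature.NumberTheory.EllipticCurves Literature.NumberTheory.GaloisRepresentations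
  Literature.NumberTheory.GaloisCohomology Summit.BirchSwinnertonDyer.Rank1Residual.GaloisImage
  Literature.NumberTheory.EllipticCurves.IwasawaAlgebra
  Summit.BirchSwinnertonDyer.Rank1Residual.Additive
  Summit.BirchSwinnertonDyer.Rank1Residual.Additive.ZpTower
  Summit.BirchSwinnertonDyer.Rank1Residual.X1.GeneratorBoundMuLayer
  Summit.BirchSwinnertonDyer.Rank1Residual.X1.GeneratorCountLayerTransport
  Summit.BirchSwinnertonDyer.Rank1Residual.X1.RelaxedKummerCountPow
open Literature.NumberTheory.GaloisRepresentations.DiscreteGaloisModule (SelmerStructure unramifiedSubgroup)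

set_option autoImplicit false

namespace Summit.BirchSwinnertonDyer.Rank1Residual.X1.LayerFixedPointsCount

variable {K : Type} [Field K] [NumberField K] (W : WeierstrassCurve K) {p : ℕ}
  [hp : Fact p.Prime] (κ : ZpExtension K p) (n : ℕ) (κn : ZpExtension (κ.layer n) p)
  (hκn : ∀ σ : Field.absoluteGaloisGroup (κ.layer n),
    (κn σ).toAdd * (p : ℤ_[p]) ^ n = (κ (resGal (K := K) (κ.layer n) σ)).toAdd)

/-! ## §1. Fixed points transported along `primaryBaseChangeEquiv` -/

include hκn in
/-- **`E_{K_n}[p^∞]^{ker κ_n}` is finite when `{b ∈ E[p^∞] | ker κ · b = b}` is**: `a ↦ β⁻¹ a`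
(`β = primaryBaseChangeEquiv`) is injective into the latter (`β⁻¹(kerOfKer τ • a) = τ • β⁻¹ a`).
[cite: GreenbergLNM1716, §3 Lemma 3.1] -/
theorem finite_fixedPoints_kerSubgroup_restrictTower
    (hfix : Set.Finite {b : geomPrimaryTorsion W p |
      ∀ τ : Field.absoluteGaloisGroup K, τ ∈ κ.kerSubgroup → τ • b = b}) :
    Finite (FixedPoints.addSubgroup κn.kerSubgroup (geomPrimaryTorsion (W.baseChange (κ.layer n)) p)) := by
  haveI := hfix.to_subtype
  refine Finite.of_injective (fun a : FixedPoints.addSubgroup κn.kerSubgroup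
      (geomPrimaryTorsion (W.baseChange (κ.layer n)) p) ↦
    (⟨(primaryBaseChangeEquiv (κ.layer n) W p).symm a.1, fun τ hτ ↦ ?_⟩ :
      {b : geomPrimaryTorsion W p |
        ∀ τ : Field.absoluteGaloisGroup K, τ ∈ κ.kerSubgroup → τ • b = b})) fun a b h ↦ ?_
  · have ha : kerOfKer κ n κn hκn ⟨τ, hτ⟩ • (a.1 : geomPrimaryTorsion (W.baseChange (κ.layer n)) p) =
        a.1 := (FixedPoints.mem_addSubgroup _ _ _).mp a.2 _
    have h := primaryBaseChangeEquiv_symm_kerOfKer_smul W κ n κn hκn ⟨τ, hτ⟩ a.1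
    rw [ha, Subgroup.smul_def] at h
    exact h.symm
  · exact Subtype.ext ((primaryBaseChangeEquiv (κ.layer n) W p).symm.injective
      (congrArg Subtype.val h))

/-- **`#E_{K_n}[p^∞]^{Γ_{K_n}} = #{b ∈ E[p^∞] | κ⁻¹(pⁿℤ_p) · b = b}`**: `a ↦ β⁻¹ a` is a bijection
(`β⁻¹(σ' • a) = resGal σ' • β⁻¹ a`, FILE 6 `primaryBaseChangeEquiv_symm_smul_gal`;
`resGal(Γ_{K_n}) = κ⁻¹(pⁿℤ_p)`, `galRange_layer_eq_layerSubgroup`).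
[cite: GreenbergLNM1716, §3 Lemma 3.1] [cite: Washington1997, §13.1] -/
theorem natCard_fixedPoints_layer_eq :
    Nat.card {a : geomPrimaryTorsion (W.baseChange (κ.layer n)) p //
        ∀ σ : Field.absoluteGaloisGroup (κ.layer n), σ • a = a} =
      Nat.card {b : geomPrimaryTorsion W p //
        ∀ σ : Field.absoluteGaloisGroup K, σ ∈ κ.layerSubgroup n → σ • b = b} := by
  refine Nat.card_congr ⟨fun a ↦ ⟨(primaryBaseChangeEquiv (κ.layer n) W p).symm a.1, fun σ hσ ↦ ?_⟩,
    fun b ↦ ⟨primaryBaseChangeEquiv (κ.layer n) W p b.1, fun σ' ↦ ?_⟩, fun a ↦ ?_, fun b ↦ ?_⟩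
  · rw [← galRange_layer_eq_layerSubgroup κ n] at hσ
    obtain ⟨σ', rfl⟩ := hσ
    change resGal (K := K) (κ.layer n) σ' • _ = _
    rw [← GeneratorCountLayerTransport.primaryBaseChangeEquiv_symm_smul_gal W κ n σ' a.1, a.2 σ']
  · apply (primaryBaseChangeEquiv (κ.layer n) W p).symm.injective
    rw [GeneratorCountLayerTransport.primaryBaseChangeEquiv_symm_smul_gal W κ n σ',
      AddEquiv.symm_apply_apply]
    exact b.2 _ (by rw [← galRange_layer_eq_layerSubgroup κ n]; exact ⟨σ', rfl⟩)
  · exact Subtype.ext ((primaryBaseChangeEquiv (κ.layer n) W p).apply_symm_apply a.1)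
  · exact Subtype.ext ((primaryBaseChangeEquiv (κ.layer n) W p).symm_apply_apply b.1)

/-! ## §2. The layer-`n` count at `v₀` with `K`-level finiteness and loss factor -/

variable {W κ} {γ : Field.absoluteGaloisGroup K} (D : W.SelmerDualData κ γ)

include hκn

/-- **The layer-`n` count with the local term imposed over `K_∞` at `v₀`, LOSSY form, `K`-level
loss factor: `p^{#T₀ + e} ≤ #(X/I_nX) · #{b ∈ E[p^∞] | Gal(K̄/K_n)·b = b}²`.** `E/K` elliptic,
`p` odd, `κ` cyclotomic, `{b ∈ E[p^∞] | ker κ · b = b}` finite (`hfix`); a Poitou–Tate family and the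
local Euler–Poincaré formula over `K_n`; `T₀` places `w ∤ p` of `K_n` with Tamagawa witnesses;
`wp ∣ v₀`, `wp ∉ T₀`, a local condition `𝓛 ⊇ 𝓚_wp` with `p^e·#𝓚_wp ≤ #𝓛` (FILE 24a); `hv₀`: every
`y` with `res_wp y ∈ 𝓛_wp` has all `Γ_K`-conjugates of `kerH1Iso (h'_0 (Ψ y))` in
`localKerOver p (ker κ) K_{v₀}` (counted by FILE 23b). [cite: GreenbergLNM1716, §3 Lemma 3.1, Lemma 3.4, §5 pp. 114–118] -/
theorem pow_card_add_le_natCard_quotient_layerIdeal_mul_sq' [W.IsElliptic]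
    [Module.Finite (IwasawaAlgebra p) D.X] [NumberField (κ.layer n)]
    (hfix : Set.Finite {b : geomPrimaryTorsion W p |
      ∀ τ : Field.absoluteGaloisGroup K, τ ∈ κ.kerSubgroup → τ • b = b})
    (hodd : p ≠ 2) (hκ : κ.IsCyclotomic)
    (inv : LocalInvariants (κ.layer n) p) (hperf : inv.IsPerfect) (hsum : inv.SumLocalTermEqZero)
    (hcompl : inv.SelmerComplement)
    (hEP : ∀ w : HeightOneSpectrum (𝓞 (κ.layer n)),
      localEulerPoincareCharacteristic (w.adicCompletion (κ.layer n)))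
    (T₀ : Finset (HeightOneSpectrum (𝓞 (κ.layer n))))
    (hT₀p : ∀ w ∈ T₀, ((p : ℕ) : 𝓞 (κ.layer n)) ∉ w.asIdeal)
    (hwit : ∀ w ∈ T₀, ∃ u ∈ unramifiedSubgroup
        (((W.baseChange (κ.layer n)).torsionGaloisModule (p : ℤ)).restrictField
          (w.adicCompletion (κ.layer n))) 1,
      u ∉ (W.baseChange (κ.layer n)).kummerLocalConditionAt (p : ℤ) (w.adicCompletion (κ.layer n)))
    (v₀ : HeightOneSpectrum (𝓞 K)) (wp : HeightOneSpectrum (𝓞 (κ.layer n))) (hwpT₀ : wp ∉ T₀)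
    (hwpv : wp.asIdeal.LiesOver v₀.asIdeal)
    (𝓛 : ∀ w : HeightOneSpectrum (𝓞 (κ.layer n)), AddSubgroup (galoisCohomology
      (((W.baseChange (κ.layer n)).torsionGaloisModule (p : ℤ)).toLocal (Sum.inr w)) 1))
    (h𝓛 : (W.baseChange (κ.layer n)).kummerSelmerStructure (p : ℤ) (Sum.inr wp) ≤ 𝓛 wp) (e : ℕ)
    (hidx : p ^ e * Nat.card ((W.baseChange (κ.layer n)).kummerSelmerStructure (p : ℤ) (Sum.inr wp)) ≤
      Nat.card (𝓛 wp))
    (hv₀ : ∀ y : galH1Torsion (W.baseChange (κ.layer n)) (p : ℤ),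
      galoisCohomology.localization ((W.baseChange (κ.layer n)).torsionGaloisModule (p : ℤ))
        (Sum.inr wp) 1 y ∈ 𝓛 wp →
      ∀ σ : Field.absoluteGaloisGroup K, W.conjH1 p κ.kerSubgroup σ
        (kerH1Iso W κ n κn hκn ((W.baseChange (κ.layer n)).layerToInfty κn 0
          (resH1Hom (Literature.NumberTheory.EllipticCurves.subgroupIncl (κn.layerSubgroup 0))
            (AddMonoidHom.id (geomPrimaryTorsion (W.baseChange (κ.layer n)) p)) (fun _ _ ↦ rfl)
            (torsionToPrimaryH1 (W.baseChange (κ.layer n)) p y)))) ∈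
        W.localKerOver p κ.kerSubgroup (v₀.adicCompletion K)) :
    p ^ (T₀.card + e) ≤ Nat.card (D.X ⧸ Ideal.span {(C (p : ℤ_[p]) : IwasawaAlgebra p),
        (1 + (X : IwasawaAlgebra p)) ^ p ^ n - 1} • (⊤ : Submodule (IwasawaAlgebra p) D.X)) *
      Nat.card {b : geomPrimaryTorsion W p //
        ∀ σ : Field.absoluteGaloisGroup K, σ ∈ κ.layerSubgroup n → σ • b = b} ^ 2 := by
  haveI := finite_fixedPoints_kerSubgroup_restrictTower W κ n κn hκn hfix
  have hκnc : κn.IsCyclotomic := ZpTower.isCyclotomic_restrictTower κ n κn hκn hκ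
  obtain ⟨S, hSfin, hcard, hS⟩ := exists_addSubgroup_relaxedKummer_at_pow
    (W := W.baseChange (κ.layer n)) hodd inv hperf hsum hcompl hEP T₀ hwit wp hwpT₀ 𝓛 h𝓛 e hidx
  haveI := hSfin
  rw [← natCard_fixedPoints_layer_eq W κ n]
  refine hcard.trans (GeneratorCountLayerLocal.natCard_le_natCard_quotient_layerIdeal_mul_sq_of_local
    n κn hκn D S v₀ (↑T₀ : Set (HeightOneSpectrum (𝓞 (κ.layer n))))
    (fun y hy w hwT hwv ↦ (hS y hy).1 w ?_) (fun y hy w ↦ (hS y hy).2.1 w) (fun y hy w hw ↦ ?_)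
    (fun y hy σ ↦ hv₀ y (hS y hy).2.2.2 σ))
  · rw [Finset.coe_insert, Set.mem_insert_iff, not_or]
    exact ⟨fun h ↦ hwv (h ▸ hwpv), hwT⟩
  · have hw' : w ∈ T₀ := Finset.mem_coe.mp hw
    exact Additive.layerToInfty_resH1Hom_torsionToPrimaryH1_mem_localKerOver_of_mem_unramified_sup_kummer
      (W.baseChange (κ.layer n)) p κn w (hT₀p w hw')
      (Additive.exists_apply_resGal_ne_one_of_isCyclotomic κn hκnc w (hT₀p w hw')) y
      ((hS y hy).2.2.1 w hw')

/-- **… in `λ`, `μ`: `p^{#T₀ + e} ≤ p^{λ(X) + pⁿμ(X)} · #{b ∈ E[p^∞] | Gal(K̄/K_n)·b = b}²`** when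
`X` is torsion without non-zero finite submodules (FILE 5) — X1R0-GAPMAP §14.1's
`t_n + a − 2δ ≤ λ + pⁿμ` with `a = e`. [cite: GreenbergLNM1716, §3 Lemma 3.1, §5 pp. 114–118, p. 137] -/
theorem pow_card_add_le_pow_mul_sq' [W.IsElliptic]
    [Module.Finite (IwasawaAlgebra p) D.X] [NumberField (κ.layer n)]
    (hfix : Set.Finite {b : geomPrimaryTorsion W p |
      ∀ τ : Field.absoluteGaloisGroup K, τ ∈ κ.kerSubgroup → τ • b = b})
    (hodd : p ≠ 2) (hX : D.IsTorsion) (hnf : ∀ N : Submodule (IwasawaAlgebra p) D.X, Finite N → N = ⊥)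
    (hκ : κ.IsCyclotomic)
    (inv : LocalInvariants (κ.layer n) p) (hperf : inv.IsPerfect) (hsum : inv.SumLocalTermEqZero)
    (hcompl : inv.SelmerComplement)
    (hEP : ∀ w : HeightOneSpectrum (𝓞 (κ.layer n)),
      localEulerPoincareCharacteristic (w.adicCompletion (κ.layer n)))
    (T₀ : Finset (HeightOneSpectrum (𝓞 (κ.layer n))))
    (hT₀p : ∀ w ∈ T₀, ((p : ℕ) : 𝓞 (κ.layer n)) ∉ w.asIdeal)
    (hwit : ∀ w ∈ T₀, ∃ u ∈ unramifiedSubgroup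
        (((W.baseChange (κ.layer n)).torsionGaloisModule (p : ℤ)).restrictField
          (w.adicCompletion (κ.layer n))) 1,
      u ∉ (W.baseChange (κ.layer n)).kummerLocalConditionAt (p : ℤ) (w.adicCompletion (κ.layer n)))
    (v₀ : HeightOneSpectrum (𝓞 K)) (wp : HeightOneSpectrum (𝓞 (κ.layer n))) (hwpT₀ : wp ∉ T₀)
    (hwpv : wp.asIdeal.LiesOver v₀.asIdeal)
    (𝓛 : ∀ w : HeightOneSpectrum (𝓞 (κ.layer n)), AddSubgroup (galoisCohomology
      (((W.baseChange (κ.layer n)).torsionGaloisModule (p : ℤ)).toLocal (Sum.inr w)) 1))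
    (h𝓛 : (W.baseChange (κ.layer n)).kummerSelmerStructure (p : ℤ) (Sum.inr wp) ≤ 𝓛 wp) (e : ℕ)
    (hidx : p ^ e * Nat.card ((W.baseChange (κ.layer n)).kummerSelmerStructure (p : ℤ) (Sum.inr wp)) ≤
      Nat.card (𝓛 wp))
    (hv₀ : ∀ y : galH1Torsion (W.baseChange (κ.layer n)) (p : ℤ),
      galoisCohomology.localization ((W.baseChange (κ.layer n)).torsionGaloisModule (p : ℤ))
        (Sum.inr wp) 1 y ∈ 𝓛 wp →
      ∀ σ : Field.absoluteGaloisGroup K, W.conjH1 p κ.kerSubgroup σ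
        (kerH1Iso W κ n κn hκn ((W.baseChange (κ.layer n)).layerToInfty κn 0
          (resH1Hom (Literature.NumberTheory.EllipticCurves.subgroupIncl (κn.layerSubgroup 0))
            (AddMonoidHom.id (geomPrimaryTorsion (W.baseChange (κ.layer n)) p)) (fun _ _ ↦ rfl)
            (torsionToPrimaryH1 (W.baseChange (κ.layer n)) p y)))) ∈
        W.localKerOver p κ.kerSubgroup (v₀.adicCompletion K)) :
    p ^ (T₀.card + e) ≤ p ^ (lambdaInvariant p D.X + p ^ n * muInvariant p D.X) *
      Nat.card {b : geomPrimaryTorsion W p //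
        ∀ σ : Field.absoluteGaloisGroup K, σ ∈ κ.layerSubgroup n → σ • b = b} ^ 2 :=
  (pow_card_add_le_natCard_quotient_layerIdeal_mul_sq' n κn hκn D hfix hodd hκ inv hperf hsum hcompl
    hEP T₀ hT₀p hwit v₀ wp hwpT₀ hwpv 𝓛 h𝓛 e hidx hv₀).trans
    (Nat.mul_le_mul_right _ (natCard_quotient_layerIdeal_le_pow D.X hX hnf n))

end Summit.BirchSwinnertonDyer.Rank1Residual.X1.LayerFixedPointsCount

end
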